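import Mathlib
import Literature.MathematicalPhysics.QuantumFieldTheory.Balaban1983to89.B16Sect1Kernels

/-!
# `Balaban1983to89.B16Prop1IVAnalytic` — [Balaban1989LargeFieldII] p. 359: *«The above equations, bounds and statements
are valid for 𝔤ᶜ-valued fields, hence the existence of the analytic extension follows immediately, and Proposition 1 [IV]
is proved»* — the ANALYTICITY of the solution of (1.13) in the abstract complex-Banach model

T. Bałaban, *Large field renormalization. II. Localization, exponentiation, and bounds for the 𝐑 operation*, Commun.
Math. Phys. **122** (1989) 355–392 [Balaban1989LargeFieldII] (cell paper B16; PDF held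
`paper:balaban1989-cmp122-large-field-ii`, journal page = PDF page + 354; p. 359 = PDF 5, text layer `p0005.txt` L17–L25,
render `run/shared/lean/pub/pub-balaban/b2b-balaban-ref1/pages/1989-cmp122-large-field-II/…-p005-x2.png` read by r13
gens 1/3/6).

statement-level skeleton of published theorems with citation tags; proofs where landed; nothing here is a claim about
the Yang–Mills mass gap

CITATION HEADER / WHAT IS REPRODUCED.  Mega-formalization `lit-balaban`, HOME `run/shared/lean/pub/lit-balaban/`;
reader/typer **r13 gen 16** (B16 display-level owner; rows `lit-balaban-r13/ROWS-B16.md`).  SKELETON row **B16.Prop1[IV]**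
(the p. 359 proof of Proposition 1 [IV]; head `proved p238958 · p249915`: `B16Sect1Kernels.fixedPoint_twice_bound`,
`B16Prop1IVAssembly.prop1IV_model(_of_bounds/_of_pos)` — existence, uniqueness, the bound, and (gen 16) the inverse from
(1.9), all over `ℝ`).  p. 359, verbatim: *«Equation (1.12) can be written as B′ + (P₀H*_{1,k}Δ₁H_{1,k}P₀)⁻¹P₀H*_{1,k}
((δ/δA)V)(H_{1,k}B′) = −(P₀H*_{1,k}Δ₁H_{1,k}P₀)⁻¹P₀H*_{1,k}J_{k,Z}. (1.13) Using Proposition 4 [15] and the fixed point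
theorem for contractive mappings, we can easily prove that the above equation has exactly one solution, which has a bound
equal to twice a bound of the right-hand side of the equation … This proves the existence and the uniqueness statements of
Proposition 1 [IV], and the bound (1.78) [IV]. The above equations, bounds and statements are valid for 𝔤ᶜ-valued fields,
hence the existence of the analytic extension follows immediately, and Proposition 1 [IV] is proved.»*  THIS FILE proves
the last sentence in the model — the one clause of the p. 359 proof the tree did not yet carry: over `ℂ`, the solution of
(1.13) is an ANALYTIC function of its right-hand side, hence of the current `J = J_{k,Z}` (through which the field `V_k`
enters (1.13) linearly).  It is the (1.13)-twin of r13 gen 10's `…B16Ineq141Solution.exists_analytic_solution140` for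
(1.40)/(1.41) p. 367 (*«We can prove again that Eq. (1.40) has exactly one solution B′_Λ(B̃′), which is an analytic
function of the 𝔤ᶜ-valued small field B̃′»* — «again» = as here), and follows that file's proof line by line.

THE MODEL (as `…B16Prop1IVAssembly`, with `ℂ` for `ℝ` since the fields are 𝔤ᶜ-valued): `E` a complex Banach space of
bond fields `B′` on `Λ` (the right-hand sides `c` of (1.13) live there too), `F` a complex normed space of fields on `T_η`;
bounded `ℂ`-linear `P₀`, `Kinv = (P₀H*Δ₁HP₀)⁻¹ : E → E`, `H = H_{1,k} : E → F`, `Hst = H*_{1,k} : F → E`; `dV = (δ/δA)V :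
F → F`.  Printed inputs as hypotheses: `‖Kinv P₀ Hst z‖ ≦ κ₁‖z‖` (κ₁ = γ₀⁻¹2d(100M)⁵·‖H*‖, p. 359 / (1.9)), `‖Hx‖ ≦ h₁‖x‖`,
`dV 0 = 0` and `dV` `ℓ`-Lipschitz on `‖u‖ ≦ ρ` (*«Proposition 4 [15]»* = [Balaban1985Variational] Prop. 4: `V` is of third
order, `ℓ` small for small fields), `κ₁ℓh₁ ≦ ½`, and for the analyticity `dV` `ℂ`-analytic on `‖u‖ < ρ`; the room
`h₁·3r ≦ ρ` for right-hand sides in the ball of radius `r`.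

WHAT IS HERE (theorems only; no `sorry`; no new definition, no `… : Prop` fact; axioms standard).
§1 plumbing (private): `I + T` invertible for `‖T‖ < 1`.  §2 **`exists_solution113`** — for `‖c‖ ≦ r`, (1.13) in the
form `x + Kinv P₀ Hst dV(Hx) = c` has a solution with `‖x‖ ≦ 2‖c‖` (*«twice a bound of the right-hand side»*;
`B16Sect1Kernels.fixedPoint_twice_bound` BY NAME); **`solution113_unique`** — two solutions in the ball `‖x‖ ≦ 3r`
coincide.  §3 **`exists_analytic_solution113`** — *«hence the existence of the analytic extension follows immediately»*:
a map `c ↦ B′(c)`, `ℂ`-ANALYTIC on the open ball `‖c‖ < r` (`AnalyticOnNhd`), solving (1.13) with `‖B′(c)‖ ≦ 2‖c‖`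
(analytic implicit function theorem at each point, Mathlib `ContDiffAt.implicitFunction` with `n = ω`; `∂_{B′}Φ = I +
Kinv P₀ Hst ∘ D(dV) ∘ H` invertible by `‖D(dV)‖ ≦ ℓ`, `κ₁ℓh₁ ≦ ½` and the Neumann series; local = global by
`solution113_unique`).  §4 **`prop1IV_analytic_in_J`** — composed with the bounded linear right-hand side
`c(J) = −Kinv P₀ Hst J`: the critical configuration `B′(J)` is analytic in the current `J` on `{J : ‖Kinv P₀ Hst J‖ < r}`,
solves (1.13) and obeys `‖B′(J)‖ ≦ 2‖Kinv P₀ Hst J‖`.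
HONEST SCOPE.  Analyticity is in the right-hand side / the current `J` only; the dependence of the operators `H_{1,k}`,
`Δ₁(ζ₀)`, `P₀` on the background `U_{k,Z}(V_k)` (also analytic in print) is not modelled — they are fixed data here, as in
every file of this row; Proposition 4 [15] and (1.9) enter as the hypotheses named above; nothing about `V`, `J_{k,Z}` is
constructed.  NOT summit progress.
-/

noncomputable section

namespace Literature.MathematicalPhysics.QuantumFieldTheory.Balaban1983to89.B16Prop1IVAnalytic

open Metric Filter
open scoped Topology ContDiff

variable {E F : Type*} [NormedAddCommGroup E] [NormedSpace ℂ E] [CompleteSpace E]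
  [NormedAddCommGroup F] [NormedSpace ℂ F]

/-! ## §1. Plumbing: `I + T` invertible for `‖T‖ < 1` -/

/-- `I + T` is an invertible bounded operator when `‖T‖ < 1` (Neumann series, `Units.oneSub`; as in
`…B16Ineq141Solution`). [folklore] -/
private theorem isInvertible_id_add {T : E →L[ℂ] E} (hT : ‖T‖ < 1) :
    (ContinuousLinearMap.id ℂ E + T).IsInvertible := by
  have hT' : ‖-T‖ < 1 := by rwa [norm_neg]
  have hval : ((Units.oneSub (-T) hT' : (E →L[ℂ] E)ˣ) : E →L[ℂ] E) = ContinuousLinearMap.id ℂ E + T := by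
    rw [Units.val_oneSub, sub_neg_eq_add]; rfl
  refine ContinuousLinearMap.IsInvertible.of_inverse (g := ((Units.oneSub (-T) hT')⁻¹ : (E →L[ℂ] E)ˣ)) ?_ ?_
  · have h := (Units.oneSub (-T) hT').mul_inv
    rwa [ContinuousLinearMap.mul_def, ContinuousLinearMap.one_def, hval] at h
  · have h := (Units.oneSub (-T) hT').inv_mul
    rwa [ContinuousLinearMap.mul_def, ContinuousLinearMap.one_def, hval] at h

/-! ## §2. (1.13) over `ℂ`: a solution with *«a bound equal to twice a bound of the right-hand side»*, exactly one -/

omit [CompleteSpace E] in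
/-- The map `B′ ↦ Kinv P₀ Hst dV(H B′)` of (1.13) is ½-Lipschitz on the ball `‖B′‖ ≦ R` as soon as `h₁R ≦ ρ`
(`‖Kinv P₀ Hst z‖ ≦ κ₁‖z‖`, `‖Hx‖ ≦ h₁‖x‖`, `dV` `ℓ`-Lipschitz on `‖u‖ ≦ ρ`, `κ₁ℓh₁ ≦ ½` — *«Proposition 4 [15]»* and
the inverse bound of p. 359). [cite: Balaban1989LargeFieldII, p.359 (after (1.13))] -/
theorem lipschitz113 (P₀ Kinv : E →L[ℂ] E) (H : E →L[ℂ] F) (Hst : F →L[ℂ] E) (dV : F → F)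
    {κ₁ h₁ ℓ ρ R : ℝ} (hκ₁ : 0 ≤ κ₁) (hh₁ : 0 ≤ h₁) (hℓ : 0 ≤ ℓ)
    (hKop : ∀ z : F, ‖Kinv (P₀ (Hst z))‖ ≤ κ₁ * ‖z‖) (hH : ∀ x : E, ‖H x‖ ≤ h₁ * ‖x‖)
    (hdV : ∀ u v : F, ‖u‖ ≤ ρ → ‖v‖ ≤ ρ → ‖dV u - dV v‖ ≤ ℓ * ‖u - v‖) (hR : h₁ * R ≤ ρ)
    (hsm1 : κ₁ * ℓ * h₁ ≤ 1 / 2) :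
    ∀ x y : E, ‖x‖ ≤ R → ‖y‖ ≤ R →
      ‖Kinv (P₀ (Hst (dV (H x)))) - Kinv (P₀ (Hst (dV (H y))))‖ ≤ 1 / 2 * ‖x - y‖ := by
  intro x y hx hy
  have hHx : ‖H x‖ ≤ ρ := (hH x).trans ((mul_le_mul_of_nonneg_left hx hh₁).trans hR)
  have hHy : ‖H y‖ ≤ ρ := (hH y).trans ((mul_le_mul_of_nonneg_left hy hh₁).trans hR)
  have h1 : Kinv (P₀ (Hst (dV (H x)))) - Kinv (P₀ (Hst (dV (H y)))) =
      Kinv (P₀ (Hst (dV (H x) - dV (H y)))) := by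
    rw [map_sub Hst, map_sub P₀, map_sub Kinv]
  rw [h1]
  have h2 : ‖dV (H x) - dV (H y)‖ ≤ ℓ * ‖H x - H y‖ := hdV _ _ hHx hHy
  have h3 : ‖H x - H y‖ ≤ h₁ * ‖x - y‖ := by rw [← map_sub]; exact hH _
  calc ‖Kinv (P₀ (Hst (dV (H x) - dV (H y))))‖ ≤ κ₁ * ‖dV (H x) - dV (H y)‖ := hKop _
    _ ≤ κ₁ * (ℓ * (h₁ * ‖x - y‖)) :=
        mul_le_mul_of_nonneg_left (h2.trans (mul_le_mul_of_nonneg_left h3 hℓ)) hκ₁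
    _ = (κ₁ * ℓ * h₁) * ‖x - y‖ := by ring
    _ ≤ 1 / 2 * ‖x - y‖ := mul_le_mul_of_nonneg_right hsm1 (norm_nonneg _)

/-- **(1.13) over `ℂ`: existence with the printed bound.**  For a right-hand side `c` with `‖c‖ ≦ r` (and the room
`h₁·3r ≦ ρ`), the equation `B′ + Kinv P₀ Hst dV(H B′) = c` has a solution with `‖B′‖ ≦ 2‖c‖` — *«exactly one solution,
which has a bound equal to twice a bound of the right-hand side of the equation»* — by `B16Sect1Kernels.fixedPoint_twice_bound`
BY NAME. [cite: Balaban1989LargeFieldII, p.359 (after (1.13))] -/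
theorem exists_solution113 (P₀ Kinv : E →L[ℂ] E) (H : E →L[ℂ] F) (Hst : F →L[ℂ] E) (dV : F → F)
    {κ₁ h₁ ℓ ρ r : ℝ} (hκ₁ : 0 ≤ κ₁) (hh₁ : 0 ≤ h₁) (hℓ : 0 ≤ ℓ)
    (hKop : ∀ z : F, ‖Kinv (P₀ (Hst z))‖ ≤ κ₁ * ‖z‖) (hH : ∀ x : E, ‖H x‖ ≤ h₁ * ‖x‖) (hdV0 : dV 0 = 0)
    (hdV : ∀ u v : F, ‖u‖ ≤ ρ → ‖v‖ ≤ ρ → ‖dV u - dV v‖ ≤ ℓ * ‖u - v‖) (hρ : h₁ * (3 * r) ≤ ρ)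
    (hsm1 : κ₁ * ℓ * h₁ ≤ 1 / 2) {c : E} (hc : ‖c‖ ≤ r) :
    ∃ x : E, ‖x‖ ≤ 2 * ‖c‖ ∧ x + Kinv (P₀ (Hst (dV (H x)))) = c := by
  have hR : h₁ * (2 * ‖c‖) ≤ ρ := by
    have : h₁ * (2 * ‖c‖) ≤ h₁ * (3 * r) := mul_le_mul_of_nonneg_left (by linarith [norm_nonneg c]) hh₁
    linarith
  have hK0 : (fun x : E => Kinv (P₀ (Hst (dV (H x))))) 0 = 0 := by simp [hdV0]
  obtain ⟨x, ⟨hxn, hxe⟩, -⟩ := B16Sect1Kernels.fixedPoint_twice_bound (fun x : E => Kinv (P₀ (Hst (dV (H x))))) c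
    hK0 (lipschitz113 P₀ Kinv H Hst dV hκ₁ hh₁ hℓ hKop hH hdV hR hsm1)
  exact ⟨x, hxn, hxe⟩

omit [CompleteSpace E] in
/-- **«exactly one»**: two solutions of `B′ + Kinv P₀ Hst dV(H B′) = c` in the ball `‖B′‖ ≦ 3r` coincide (room
`h₁·3r ≦ ρ`). [cite: Balaban1989LargeFieldII, p.359 (after (1.13))] -/
theorem solution113_unique (P₀ Kinv : E →L[ℂ] E) (H : E →L[ℂ] F) (Hst : F →L[ℂ] E) (dV : F → F)
    {κ₁ h₁ ℓ ρ r : ℝ} (hκ₁ : 0 ≤ κ₁) (hh₁ : 0 ≤ h₁) (hℓ : 0 ≤ ℓ)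
    (hKop : ∀ z : F, ‖Kinv (P₀ (Hst z))‖ ≤ κ₁ * ‖z‖) (hH : ∀ x : E, ‖H x‖ ≤ h₁ * ‖x‖)
    (hdV : ∀ u v : F, ‖u‖ ≤ ρ → ‖v‖ ≤ ρ → ‖dV u - dV v‖ ≤ ℓ * ‖u - v‖) (hρ : h₁ * (3 * r) ≤ ρ)
    (hsm1 : κ₁ * ℓ * h₁ ≤ 1 / 2) {c x y : E} (hx : ‖x‖ ≤ 3 * r) (hy : ‖y‖ ≤ 3 * r)
    (hxe : x + Kinv (P₀ (Hst (dV (H x)))) = c) (hye : y + Kinv (P₀ (Hst (dV (H y)))) = c) : x = y := by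
  have hL := lipschitz113 P₀ Kinv H Hst dV hκ₁ hh₁ hℓ hKop hH hdV hρ hsm1 x y hx hy
  have e : x - y = -(Kinv (P₀ (Hst (dV (H x)))) - Kinv (P₀ (Hst (dV (H y))))) := by
    have h : x + Kinv (P₀ (Hst (dV (H x)))) - (y + Kinv (P₀ (Hst (dV (H y))))) = 0 := by
      rw [hxe, hye, sub_self]
    have h' : x - y + (Kinv (P₀ (Hst (dV (H x)))) - Kinv (P₀ (Hst (dV (H y))))) = 0 := by
      rw [← h]; abel
    exact eq_neg_of_add_eq_zero_left h'
  have h3 : ‖x - y‖ ≤ 1 / 2 * ‖x - y‖ := by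
    calc ‖x - y‖ = ‖Kinv (P₀ (Hst (dV (H x)))) - Kinv (P₀ (Hst (dV (H y))))‖ := by rw [e, norm_neg]
      _ ≤ 1 / 2 * ‖x - y‖ := hL
  have h4 : ‖x - y‖ = 0 := le_antisymm (by linarith [norm_nonneg (x - y)]) (norm_nonneg _)
  exact sub_eq_zero.mp (norm_eq_zero.mp h4)

/-! ## §3. *«hence the existence of the analytic extension follows immediately»* -/

/-- **p. 359, verbatim: *«The above equations, bounds and statements are valid for 𝔤ᶜ-valued fields, hence the existence
of the analytic extension follows immediately, and Proposition 1 [IV] is proved.»*** — in the complex model, with `dV`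
moreover `ℂ`-analytic on the open ball `‖u‖ < ρ` (`0 < ρ`): there is a map `c ↦ B′(c)`, `ℂ`-ANALYTIC on the open ball
`‖c‖ < r` (`AnalyticOnNhd`), such that for every `‖c‖ < r` the value `B′(c)` solves (1.13) with right-hand side `c` and
`‖B′(c)‖ ≦ 2‖c‖`.  PROOF (that of `…B16Ineq141Solution.exists_analytic_solution140`, line by line): `B′` = the solution
of `exists_solution113`; at each `c₀` the analytic implicit function theorem (Mathlib `ContDiffAt.implicitFunction`,
`n = ω`; `∂_{B′}Φ = I + Kinv P₀ Hst ∘ D(dV) ∘ H` invertible by `‖D(dV)‖ ≦ ℓ`, `κ₁ℓh₁ ≦ ½` and the Neumann series) gives an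
analytic local solution through `B′(c₀)`, equal to `B′` near `c₀` by `solution113_unique`. [cite: Balaban1989LargeFieldII,
p.359 (proof of Proposition 1 [IV], last sentences)] -/
theorem exists_analytic_solution113 (P₀ Kinv : E →L[ℂ] E) (H : E →L[ℂ] F) (Hst : F →L[ℂ] E) (dV : F → F)
    {κ₁ h₁ ℓ ρ r : ℝ} (hκ₁ : 0 ≤ κ₁) (hh₁ : 0 ≤ h₁) (hℓ : 0 ≤ ℓ) (hρ0 : 0 < ρ)
    (hKop : ∀ z : F, ‖Kinv (P₀ (Hst z))‖ ≤ κ₁ * ‖z‖) (hH : ∀ x : E, ‖H x‖ ≤ h₁ * ‖x‖) (hdV0 : dV 0 = 0)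
    (hdV : ∀ u v : F, ‖u‖ ≤ ρ → ‖v‖ ≤ ρ → ‖dV u - dV v‖ ≤ ℓ * ‖u - v‖)
    (hA : ∀ u : F, ‖u‖ < ρ → AnalyticAt ℂ dV u)
    (hρ : h₁ * (3 * r) ≤ ρ) (hsm1 : κ₁ * ℓ * h₁ ≤ 1 / 2) :
    ∃ sol : E → E, AnalyticOnNhd ℂ sol (ball (0 : E) r) ∧
      ∀ c : E, ‖c‖ < r → ‖sol c‖ ≤ 2 * ‖c‖ ∧ sol c + Kinv (P₀ (Hst (dV (H (sol c))))) = c := by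
  classical
  -- the solution map: the solution of `exists_solution113` inside the closed ball, 0 outside
  have hex : ∀ c : E, ‖c‖ ≤ r → ∃ x : E, ‖x‖ ≤ 2 * ‖c‖ ∧ x + Kinv (P₀ (Hst (dV (H x)))) = c :=
    fun c hc => exists_solution113 P₀ Kinv H Hst dV hκ₁ hh₁ hℓ hKop hH hdV0 hdV hρ hsm1 hc
  let sol : E → E := fun c => if h : ‖c‖ ≤ r then Classical.choose (hex c h) else 0
  have hsol : ∀ c : E, ‖c‖ ≤ r → ‖sol c‖ ≤ 2 * ‖c‖ ∧ sol c + Kinv (P₀ (Hst (dV (H (sol c))))) = c := by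
    intro c hc
    have e : sol c = Classical.choose (hex c hc) := by simp only [sol, dif_pos hc]
    rw [e]
    exact Classical.choose_spec (hex c hc)
  refine ⟨sol, ?_, fun c hc => hsol c hc.le⟩
  -- analyticity at every point of the open ball
  intro c₀ hc₀m
  have hc₀ : ‖c₀‖ < r := mem_ball_zero_iff.mp hc₀m
  have hr : 0 < r := lt_of_le_of_lt (norm_nonneg _) hc₀
  obtain ⟨hx₀n, hx₀e⟩ := hsol c₀ hc₀.le
  set x₀ : E := sol c₀ with hx₀
  -- x₀ lies strictly inside the uniqueness ball
  have hx₀_lt : ‖x₀‖ < 3 * r := by linarith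
  -- the base argument u₀ = H x₀ lies in the open analyticity ball
  have hu₀ : ‖H x₀‖ < ρ := by
    have h1 := hH x₀
    rcases eq_or_lt_of_le hh₁ with h0 | hpos
    · have : h₁ * ‖x₀‖ = 0 := by rw [← h0, zero_mul]
      linarith
    · have h3 : h₁ * ‖x₀‖ < h₁ * (3 * r) := mul_lt_mul_of_pos_left hx₀_lt hpos
      linarith
  -- the implicit equation Φ(c, B′) = B′ + Kinv P₀ Hst dV(H B′) − c
  set KPH : F →L[ℂ] E := Kinv.comp (P₀.comp Hst) with hKPH
  have hKPH_apply : ∀ z : F, KPH z = Kinv (P₀ (Hst z)) := fun z => rfl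
  set Lm : E × E →L[ℂ] F := H.comp (ContinuousLinearMap.snd ℂ E E) with hLm
  have hLm_apply : ∀ v : E × E, Lm v = H v.2 := fun v => rfl
  set Cst : E × E →L[ℂ] E := -ContinuousLinearMap.fst ℂ E E with hCst
  have hCst_apply : ∀ v : E × E, Cst v = -v.1 := fun v => rfl
  set Φ : E × E → E := fun v => v.2 + KPH (dV (Lm v)) + Cst v with hΦ
  have hΦ_apply : ∀ c x : E, Φ (c, x) = x + Kinv (P₀ (Hst (dV (H x)))) + -c := fun c x => rfl
  have hLm₀ : Lm (c₀, x₀) = H x₀ := rfl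
  -- Φ is analytic at (c₀, x₀)
  have hA₀ : AnalyticAt ℂ dV (Lm (c₀, x₀)) := by rw [hLm₀]; exact hA _ hu₀
  have hΦan : AnalyticAt ℂ Φ (c₀, x₀) :=
    (analyticAt_snd.add ((KPH.analyticAt _).comp (hA₀.comp (Lm.analyticAt _)))).add (Cst.analyticAt _)
  have hΦcd : ContDiffAt ℂ ω Φ (c₀, x₀) := hΦan.contDiffAt
  -- the derivative of dV at u₀ and its norm ≤ ℓ (converse mean value inequality)
  set T₀ : F →L[ℂ] F := fderiv ℂ dV (Lm (c₀, x₀)) with hT₀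
  have hdVd : HasFDerivAt dV T₀ (Lm (c₀, x₀)) := hA₀.differentiableAt.hasFDerivAt
  have hT₀_norm : ‖T₀‖ ≤ ℓ := by
    refine hdVd.le_of_lip' hℓ ?_
    have hopen : IsOpen {u : F | ‖u‖ < ρ} := isOpen_lt continuous_norm continuous_const
    have hmem : {u : F | ‖u‖ < ρ} ∈ 𝓝 (Lm (c₀, x₀)) := hopen.mem_nhds (by rw [hLm₀]; exact hu₀)
    filter_upwards [hmem] with u hu
    exact hdV u _ hu.le (by rw [hLm₀]; exact hu₀.le)
  -- the derivative of Φ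
  set Φ' : E × E →L[ℂ] E := ContinuousLinearMap.snd ℂ E E + KPH.comp (T₀.comp Lm) + Cst with hΦ'
  have hΦd : HasFDerivAt Φ Φ' (c₀, x₀) := by
    have h1 : HasFDerivAt (fun v : E × E => KPH (dV (Lm v))) (KPH.comp (T₀.comp Lm)) (c₀, x₀) :=
      KPH.hasFDerivAt.comp (c₀, x₀) (hdVd.comp (c₀, x₀) Lm.hasFDerivAt)
    exact (hasFDerivAt_snd.add h1).add Cst.hasFDerivAt
  -- the partial derivative in B′ is I + Kinv P₀ Hst ∘ D(dV) ∘ H, invertible by the Neumann series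
  have hpartial : Φ'.comp (ContinuousLinearMap.inr ℂ E E) =
      ContinuousLinearMap.id ℂ E + KPH.comp (T₀.comp H) := by
    ext x
    simp [hΦ', hLm, hCst]
  have hsmall : ‖KPH.comp (T₀.comp H)‖ < 1 := by
    have hbd : ∀ x : E, ‖(KPH.comp (T₀.comp H)) x‖ ≤ (κ₁ * ℓ * h₁) * ‖x‖ := by
      intro x
      calc ‖(KPH.comp (T₀.comp H)) x‖ = ‖Kinv (P₀ (Hst (T₀ (H x))))‖ := rfl
        _ ≤ κ₁ * ‖T₀ (H x)‖ := hKop _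
        _ ≤ κ₁ * (ℓ * (h₁ * ‖x‖)) := by
            refine mul_le_mul_of_nonneg_left ?_ hκ₁
            exact (T₀.le_opNorm _).trans (mul_le_mul hT₀_norm (hH x) (norm_nonneg _) hℓ)
        _ = (κ₁ * ℓ * h₁) * ‖x‖ := by ring
    have hop : ‖KPH.comp (T₀.comp H)‖ ≤ κ₁ * ℓ * h₁ :=
      ContinuousLinearMap.opNorm_le_bound _ (by positivity) hbd
    linarith
  have hinv : (fderiv ℂ Φ (c₀, x₀) ∘L ContinuousLinearMap.inr ℂ E E).IsInvertible := by
    rw [hΦd.fderiv, hpartial]; exact isInvertible_id_add hsmall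
  -- the analytic implicit function ψ near c₀
  have hω : (ω : ℕ∞ω) ≠ 0 := by simp
  have hψ₀ : hΦcd.implicitFunction hω hinv c₀ = x₀ := hΦcd.implicitFunction_apply_self hω hinv
  have hψcd : ContDiffAt ℂ ω (hΦcd.implicitFunction hω hinv) c₀ := hΦcd.contDiffAt_implicitFunction hω hinv
  have hψeq : ∀ᶠ c in 𝓝 c₀, Φ (c, hΦcd.implicitFunction hω hinv c) = Φ (c₀, x₀) :=
    hΦcd.eventually_apply_implicitFunction hω hinv
  have hΦ₀ : Φ (c₀, x₀) = 0 := by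
    rw [hΦ_apply, hx₀e, add_neg_cancel]
  -- ψ stays inside the uniqueness ball and c inside the ball of right-hand sides, near c₀
  have hψball : ∀ᶠ c in 𝓝 c₀, ‖hΦcd.implicitFunction hω hinv c‖ < 3 * r := by
    have hc : ContinuousAt (hΦcd.implicitFunction hω hinv) c₀ := hψcd.continuousAt
    have hopen : IsOpen {y : E | ‖y‖ < 3 * r} := isOpen_lt continuous_norm continuous_const
    exact hc.preimage_mem_nhds (hopen.mem_nhds (by rw [Set.mem_setOf_eq, hψ₀]; exact hx₀_lt))
  have hcball : ∀ᶠ c in 𝓝 c₀, ‖c‖ < r := (isOpen_lt continuous_norm continuous_const).mem_nhds hc₀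
  -- hence sol = ψ near c₀ by «exactly one solution»
  have hEq : sol =ᶠ[𝓝 c₀] hΦcd.implicitFunction hω hinv := by
    filter_upwards [hψeq, hψball, hcball] with c hc hcb hcr
    obtain ⟨hsn, hse⟩ := hsol c hcr.le
    have hψe : hΦcd.implicitFunction hω hinv c +
        Kinv (P₀ (Hst (dV (H (hΦcd.implicitFunction hω hinv c))))) = c := by
      rw [hΦ₀, hΦ_apply] at hc
      have := eq_neg_of_add_eq_zero_left hc
      rw [neg_neg] at this
      exact this
    have hsn' : ‖sol c‖ ≤ 3 * r := by linarith
    exact solution113_unique P₀ Kinv H Hst dV hκ₁ hh₁ hℓ hKop hH hdV hρ hsm1 hsn' hcb.le hse hψe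
  exact (hψcd.congr_of_eventuallyEq hEq).analyticAt

/-! ## §4. The critical configuration as an analytic function of the current `J` -/

/-- **Proposition 1 [IV], analytic extension (p. 359), as a function of the current.**  With the right-hand side of
(1.13) `c(J) = −Kinv P₀ Hst J` (bounded `ℂ`-linear in `J = J_{k,Z}`), the critical configuration `B′(J) := sol(c(J))`
of `exists_analytic_solution113` is `ℂ`-analytic at every `J` with `‖Kinv P₀ Hst J‖ < r`, solves (1.13)
`B′ + Kinv P₀ Hst dV(H B′) = −Kinv P₀ Hst J`, and `‖B′(J)‖ ≦ 2‖Kinv P₀ Hst J‖` (*«twice a bound of the right-hand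
side»*; with `‖Kinv P₀ Hst J‖ ≦ κ₁‖J‖` this is the printed `2γ₀⁻¹2d(100M)⁵·B₃²4ε_k` once `‖J‖` is bounded as in
`B16.prop1_chain_M7`). [cite: Balaban1989LargeFieldII, p.359 (proof of Proposition 1 [IV]); Balaban1989LargeFieldI,
Proposition 1 p.194] -/
theorem prop1IV_analytic_in_J (P₀ Kinv : E →L[ℂ] E) (H : E →L[ℂ] F) (Hst : F →L[ℂ] E) (dV : F → F)
    {κ₁ h₁ ℓ ρ r : ℝ} (hκ₁ : 0 ≤ κ₁) (hh₁ : 0 ≤ h₁) (hℓ : 0 ≤ ℓ) (hρ0 : 0 < ρ)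
    (hKop : ∀ z : F, ‖Kinv (P₀ (Hst z))‖ ≤ κ₁ * ‖z‖) (hH : ∀ x : E, ‖H x‖ ≤ h₁ * ‖x‖) (hdV0 : dV 0 = 0)
    (hdV : ∀ u v : F, ‖u‖ ≤ ρ → ‖v‖ ≤ ρ → ‖dV u - dV v‖ ≤ ℓ * ‖u - v‖)
    (hA : ∀ u : F, ‖u‖ < ρ → AnalyticAt ℂ dV u)
    (hρ : h₁ * (3 * r) ≤ ρ) (hsm1 : κ₁ * ℓ * h₁ ≤ 1 / 2) :
    ∃ Bsol : F → E,
      (∀ J : F, ‖Kinv (P₀ (Hst J))‖ < r → AnalyticAt ℂ Bsol J) ∧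
      ∀ J : F, ‖Kinv (P₀ (Hst J))‖ < r →
        ‖Bsol J‖ ≤ 2 * ‖Kinv (P₀ (Hst J))‖ ∧
          Bsol J + Kinv (P₀ (Hst (dV (H (Bsol J))))) = -(Kinv (P₀ (Hst J))) := by
  obtain ⟨sol, hsolA, hsol⟩ :=
    exists_analytic_solution113 P₀ Kinv H Hst dV hκ₁ hh₁ hℓ hρ0 hKop hH hdV0 hdV hA hρ hsm1
  set cJ : F →L[ℂ] E := -(Kinv.comp (P₀.comp Hst)) with hcJ
  have hcJ_apply : ∀ J : F, cJ J = -(Kinv (P₀ (Hst J))) := fun J => rfl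
  refine ⟨fun J => sol (cJ J), ?_, ?_⟩
  · intro J hJ
    have hmem : cJ J ∈ ball (0 : E) r := by
      rw [mem_ball_zero_iff, hcJ_apply, norm_neg]; exact hJ
    exact (hsolA (cJ J) hmem).comp (cJ.analyticAt J)
  · intro J hJ
    have hn : ‖cJ J‖ < r := by rw [hcJ_apply, norm_neg]; exact hJ
    obtain ⟨h1, h2⟩ := hsol (cJ J) hn
    refine ⟨?_, ?_⟩
    · rw [hcJ_apply, norm_neg] at h1; exact h1
    · rw [hcJ_apply] at h2; exact h2

end Literature.MathematicalPhysics.QuantumFieldTheory.Balaban1983to89.B16Prop1IVAnalytic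

end
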